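import Literature.AnabelianGeometry.AbsoluteAnabelian.AbsTopIII.AutHolLogFrobeniusProofs
import Literature.AnabelianGeometry.AbsoluteAnabelian.AbsTopIII.AutHolLogFrobeniusTelecoreIncompatibility
import Literature.AnabelianGeometry.AbsoluteAnabelian.AbsTopIII.FrobeniusPictureMLFTelecoreProofs
import Literature.AnabelianGeometry.AbsoluteAnabelian.AbsTopIII.FrobeniusPictureMLFNexusProofs
import Mathlib.CategoryTheory.Types.Basic
import HarnessLib

/-!
# [AbsTopIII] §4, Corollary 4.5 assembled from its discharged items: the residual MODEL inputs

Mochizuki, *Topics in Absolute Anabelian Geometry III*, §4, Corollary 4.5 (i)–(v) pp. 107–110 of the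
author's kurims manuscript (lit key `paper:url-5493eb38cbb7`; bib key `MochizukiAbsTopIII2015`).
PROOF-ONLY companion (abc-iut cell, sub-DAG `AbsTopIII:Cor4.5 (i)(iv)(v)` of
plan/L4/SUBDAG-AbsTopIII-Cor45.md, row `C45-L00 Assembly`; seat abc-iut-w5-d210).  No new notion is
declared; every statement proved here is one of abc-iut-L4-t10's named statements `Cor_4_5_*`
(`AutHolLogFrobenius.lean`) over the ABSTRACT input data `Δ : LogFrobeniusData`.

What the tree already has, item by item, over abstract data: (i) `cor_4_5_i_holds` (every `Δ`);
(ii) `cor_4_5_ii_of_coherent` (abc-iut-L4-t5; modulo `id_⋎` fully faithful and `τ` coherent — both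
identities in print); (iii) `cor_4_5_iii_holds` (every `Δ`); (iv) `cor_4_5_iv_of_lemma44` (modulo the
Aut-holomorphic orientation `ι_× : λ^∼ → λ^×`, an object of `LinHol`, and the component-level content
`Lemma44Property` of Lemma 4.4); (v) `cor_4_5_v_of_rigid` (modulo total rigidity of `𝒟_{≤□}`).
This file adds:

* `cor_4_5_v_of_isIdRigid` / `cor_4_5_v_of_isEquivalence` — (v) from the SINGLE printed input "the
  total `□`-rigidity portion of assertion (v) follows immediately from Proposition 4.2, (i) [cf. also
  the final portion of Proposition 4.2, (ii)]" (p. 110): id-rigidity of `𝒳 = 𝒞^hol_T` (Prop. 4.2 (i))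
  — via abc-iut-L4-t5's `nexusRigidStmt_of` / `nexusRigidStmt_of_isEquivalence` (the rigidity of
  `log ≅ 𝟭`, Prop. 4.2 (ii), is derived there from `logIsoId`);
* `lemma44Property_of_not_bijective` — the printed sentence "by writing out explicitly the meaning
  of such an equality `ζ'₁ = id`, we conclude that we obtain a contradiction to Lemma 4.4" (p. 110):
  `Lemma44Property ι` follows as soon as SOME functor `Φ : 𝒩 ⥤ Type` ("underlying arithmetic datum")
  carries each composite `λ^×(a) ≫ ι_log,⋎ ≫ ι_×` (`a` an isomorphism) to a NON-BIJECTIVE map — for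
  the data of Def. 4.1 this map is `k^× →α (k~)^× ↪ k~ ↠ k^×` and non-bijectivity is Lemma 4.4
  (`addMulDistinguishableArch` for `k = ℂ` in abc-iut-L4-t14's staged `ArchimedeanLogFrobeniusFunctors`);
* `cor_4_5_of_inputs` / `cor_4_5_of_inputs'` — **Cor. 4.5 (i)–(v) (`Cor_4_5 Δ τ`) REDUCED TO ITS
  PRINTED MODEL INPUTS**: orientation `ι_× = inr ι`, an object `a₀` of `LinHol`, `Lemma44Property ι`
  (Lemma 4.4), id-rigidity of `𝒳` (Prop. 4.2 (i)) [resp. total rigidity of `𝒟_{≤□}`], and the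
  printed-case shape hypotheses of (ii) (`id_⋎` fully faithful, `τ` coherent).  These binders are
  EXACTLY the rows of the sub-DAG that wait on the (unbuilt) archimedean model of Def. 4.1 (iii)–(v);
  nothing else is assumed.

Refereed pre-IUT anabelian geometry ([AbsTopIII] is undisputed); nothing here bears on [IUTchIII]
Cor. 3.12 or takes a side; typed ≠ discharged — the geometric INSTANCE is not constructed here.
-/

namespace Literature.AnabelianGeometry.AbsoluteAnabelian.AbsTopIII

open _root_.CategoryTheory

universe w u

variable {Δ : LogFrobeniusData.{u}}

/-! ### Corollary 4.5 (v) from id-rigidity (Prop. 4.2 (i)) -/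

/-- **Cor. 4.5 (v) from id-rigidity**: if the categories `X₁` (first row) and `𝒳` (at `□`) are id-rigid
and `id_⋎ : X₁ ⥤ 𝒳` is rigid, then "`□` is a nexus of `Γ⃗_𝒟`, `𝒟` is totally `□`-rigid, and the
natural action of `ℤ` … extends to an action of `ℤ` on `𝒟` by nexus-classes of self-equivalences"
(`Cor_4_5_v Δ`).  Printed proof p. 110: "follows immediately from Proposition 4.2, (i) [cf. also the
final portion of Proposition 4.2, (ii)]".
[cite: MochizukiAbsTopIII2015, Corollary 4.5 (v) p.109] -/
theorem cor_4_5_v_of_isIdRigid (hX₁ : IsIdRigid Δ.X₁) (hX : IsIdRigid Δ.X)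
    (htn : IsRigidFunctor Δ.toNexus) :
    Literature.AnabelianGeometry.AbsoluteAnabelian.AbsTopIII.Cor_4_5_v Δ :=
  ⟨Δ.nexusRigidStmt_of hX₁ hX htn, Δ.shiftStmt⟩

/-- **Cor. 4.5 (v) from the SINGLE printed input** — in Cor. 4.5 proper the first row IS `𝒳` and
`id_⋎` is the identity functor, so `toNexus` is an equivalence and the only input is the id-rigidity
of `𝒳 = 𝒞^hol_T` (Prop. 4.2 (i): "`EA`, `𝒞^hol_T`, `𝒞^{hol-sB}_T` are id-rigid").
[cite: MochizukiAbsTopIII2015, Corollary 4.5 (v) p.109] -/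
theorem cor_4_5_v_of_isEquivalence [Δ.toNexus.IsEquivalence] (hX : IsIdRigid Δ.X) :
    Literature.AnabelianGeometry.AbsoluteAnabelian.AbsTopIII.Cor_4_5_v Δ :=
  ⟨Δ.nexusRigidStmt_of_isEquivalence hX, Δ.shiftStmt⟩

/-! ### The Lemma-4.4 property from a non-bijective underlying map -/

/-- **"Writing out explicitly the meaning of `ζ'₁ = id` … a contradiction to Lemma 4.4"** (proof of
Cor. 4.5 (iv), p. 110), abstractly: if some functor `Φ : 𝒩 ⥤ Type` (at the model: "arithmetic data
of type `TLG` of a typical object", p. 109) takes every composite `λ^×(a) ≫ ι_log,⋎(x) ≫ ι_×` with `a`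
an isomorphism `id_⋎(x) ⥲ id_⋎(log x)` to a map that is NOT bijective (at the model this map is
`k^× →α (k~)^× ↪ k~ ↠ k^×`, non-bijective by Lemma 4.4), then the input datum has the
`Lemma44Property` (the composite is never the identity).
[cite: MochizukiAbsTopIII2015, Corollary 4.5 (iv) p.110] -/
theorem lemma44Property_of_not_bijective (ι : Δ.lamPf ⟶ Δ.lamTimes) (Φ : Δ.N ⥤ Type w)
    (h : ∀ (x : Δ.X₁) (a : Δ.toNexus.obj x ⟶ Δ.toNexus.obj (Δ.log.obj x)), IsIso a →
      ¬ Function.Bijective (Φ.map (Δ.lamTimes.map a ≫ ιlogApp x ≫ ι.app (Δ.toNexus.obj x)))) :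
    Lemma44Property ι := by
  intro x a ha heq
  apply h x a ha
  rw [heq, Φ.map_id]
  exact Function.bijective_id

/-! ### Corollary 4.5 assembled: the residual model inputs, by name -/

/-- **[AbsTopIII] Cor. 4.5 (i)–(v) over the abstract data, REDUCED TO ITS PRINTED MODEL INPUTS**
(`Cor_4_5 Δ τ = Δ.LogFrobeniusCompatible τ`): for a log-Frobenius input datum of Aut-holomorphic type
(`ι_× = ι : λ^∼ → λ^×`, Rmk. 4.5.2) such that `LinHol` has an object `a₀`, `ι` has the Lemma-4.4
property (Lemma 4.4 p. 107 for the data of Def. 4.1), the categories `X₁`, `𝒳` are id-rigid and `id_⋎`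
is rigid (Prop. 4.2 (i)), and — printed-case shape hypotheses of (ii) — `id_⋎` is fully faithful and
`τ` is coherent.  Items: (i) `cor_4_5_i_holds` (abc-iut-L4-t10 over abc-iut-L4-t5's cores), (ii)
`cor_4_5_ii_of_coherent` (t5), (iii) `cor_4_5_iii_holds` (t10 / abc-iut-w4-d095), (iv)
`cor_4_5_iv_of_lemma44` (t10), (v) `cor_4_5_v_of_isIdRigid` (this file, over t5).
[cite: MochizukiAbsTopIII2015, Corollary 4.5 pp.107–109] -/
theorem cor_4_5_of_inputs (τ : Δ.TelecoreData)
    (hν : Δ.toNexus.FullyFaithful)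
    (hτ : ∀ x : Δ.X₁, Δ.toNexus.map (τ.η₁.hom.app x) =
      τ.e.hom.app (Δ.κ.obj (Δ.XtoE.obj (Δ.toNexus.obj x))) ≫ Δ.η.hom.app (Δ.toNexus.obj x))
    (ι : Δ.lamPf ⟶ Δ.lamTimes) (hι : Δ.ιtimes = Sum.inr ι) (a₀ : Δ.A) (h44 : Lemma44Property ι)
    (hX₁ : IsIdRigid Δ.X₁) (hX : IsIdRigid Δ.X) (htn : IsRigidFunctor Δ.toNexus) :
    Literature.AnabelianGeometry.AbsoluteAnabelian.AbsTopIII.Cor_4_5 Δ τ :=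
  (cor_4_5_iff Δ τ).mpr
    ⟨cor_4_5_i_holds Δ, Δ.cor_4_5_ii_of_coherent τ hν hτ, cor_4_5_iii_holds Δ,
      cor_4_5_iv_of_lemma44 τ ι hι a₀ h44, cor_4_5_v_of_isIdRigid hX₁ hX htn⟩

/-- **[AbsTopIII] Cor. 4.5 (i)–(v), variant with the total rigidity of `𝒟_{≤□}` as the (v)-input**
(abc-iut-L4-t10's `cor_4_5_v_of_rigid` shape; equivalent to the nexus statement by t5's
`nexusRigidStmt_iff`). [cite: MochizukiAbsTopIII2015, Corollary 4.5 pp.107–109] -/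
theorem cor_4_5_of_inputs' (τ : Δ.TelecoreData)
    (hν : Δ.toNexus.FullyFaithful)
    (hτ : ∀ x : Δ.X₁, Δ.toNexus.map (τ.η₁.hom.app x) =
      τ.e.hom.app (Δ.κ.obj (Δ.XtoE.obj (Δ.toNexus.obj x))) ≫ Δ.η.hom.app (Δ.toNexus.obj x))
    (ι : Δ.lamPf ⟶ Δ.lamTimes) (hι : Δ.ιtimes = Sum.inr ι) (a₀ : Δ.A) (h44 : Lemma44Property ι)
    (hrig : (Δ.diagram.restrict ({a : LFVertex | a.row = 1} ∪ {LFVertex.nexus})).IsTotallyRigid) :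
    Literature.AnabelianGeometry.AbsoluteAnabelian.AbsTopIII.Cor_4_5 Δ τ :=
  (cor_4_5_iff Δ τ).mpr
    ⟨cor_4_5_i_holds Δ, Δ.cor_4_5_ii_of_coherent τ hν hτ, cor_4_5_iii_holds Δ,
      cor_4_5_iv_of_lemma44 τ ι hι a₀ h44, cor_4_5_v_of_rigid Δ hrig⟩

/-- **Cor. 4.5 in print's own configuration** (first row `= 𝒳`, `id_⋎` an equivalence — in print
the identity): the inputs shrink to the orientation, an object of `LinHol`, the Lemma-4.4 property,
the id-rigidity of `𝒳` (Prop. 4.2 (i)) and the coherence of `τ`.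
[cite: MochizukiAbsTopIII2015, Corollary 4.5 pp.107–109] -/
theorem cor_4_5_of_inputs_of_isEquivalence [Δ.toNexus.IsEquivalence] (τ : Δ.TelecoreData)
    (hτ : ∀ x : Δ.X₁, Δ.toNexus.map (τ.η₁.hom.app x) =
      τ.e.hom.app (Δ.κ.obj (Δ.XtoE.obj (Δ.toNexus.obj x))) ≫ Δ.η.hom.app (Δ.toNexus.obj x))
    (ι : Δ.lamPf ⟶ Δ.lamTimes) (hι : Δ.ιtimes = Sum.inr ι) (a₀ : Δ.A) (h44 : Lemma44Property ι)
    (hX : IsIdRigid Δ.X) :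
    Literature.AnabelianGeometry.AbsoluteAnabelian.AbsTopIII.Cor_4_5 Δ τ :=
  (cor_4_5_iff Δ τ).mpr
    ⟨cor_4_5_i_holds Δ, Δ.cor_4_5_ii_of_coherent τ (Functor.FullyFaithful.ofFullyFaithful _) hτ,
      cor_4_5_iii_holds Δ, cor_4_5_iv_of_lemma44 τ ι hι a₀ h44, cor_4_5_v_of_isEquivalence hX⟩

end Literature.AnabelianGeometry.AbsoluteAnabelian.AbsTopIII
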